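import Mathlib
import Literature.Computability.AlgebraicComplexity.BorderDcQuadraticBoundProofs
import Summits.ValiantsHypothesis.ValiantsHypothesis.Theorems.BorderApolarityToricWitnessObstructionQPTLFChart
import Summits.ValiantsHypothesis.ValiantsHypothesis.Theorems.BorderApolarityToricWitnessObstructionQPBorder33

/-!
# Border apolarity, crux `ToricWitnessObstructionQP` — torus leading forms are border
# determinantal expressions (`TLF n m ⟹ X₀₀^{m-n} per_n ∈ Δ[det_m]`, `n < m`)

Route `ValiantsHypothesis/BorderApolarity`, crux item `stmt-ValiantsHypothesis-14753`, line `Sketch`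
(lead c6).  The disprover's §5(c) (informal) and the calibration of the line's residual objects:

* `TLFChart.top_component_mem_orbitClosure_det`: for ANY `m × m` matrix `M` of linear forms in the
  `m²` variables, any scalar `c`, weight `w` and `e` bounding the `w`-weights of `c · det M`, the top
  component `(c · det M)_{w = e}` lies in the orbit closure `Δ[det_m]` (torus degeneration
  `s^{-e} · (c det M)(s^w x) → top`, `End · det_m ⊆ Δ[det_m]`, Euclidean limits stay in `Δ`;
  Border33's argument for general `m`).
* `tlf_paddedPerPoly_mem_orbitClosure`: a torus leading form datum of size `m` for `per_n`,
  `n < m` (`deg_s det(s^{a₀}G₀ + Σ s^{γ} X G) ≤ e'`, `[s^{e'}] det = per_n`) gives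
  `X₀₀^{m-n} per_n ∈ Δ[det_m]`, i.e. `bdc(per_n) ≤ m`: by the chart lemma (`tlf_chart`) the padded
  permanent is the top torus-weight component of an honest linear determinant over the ten
  variables `Option (Fin n × Fin n)`, which is renamed into the `m²` variables.
* `tlf_sq_le_two_mul`: hence `n² ≤ 2m` (Landsberg–Manivel–Ressayre, in tree): e.g. no TLF(3,4),
  no TLF(4,7); and a TLF(3,5) or TLF(3,6) — the smallest open instances of Stub A — would be a
  kernel-checkable proof of `bdc(per₃) ≤ 6 < 7 = dc(per₃)`.
-/

open MvPolynomial Filter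
open scoped BigOperators Matrix Polynomial Topology

-- the mandated summit-side namespace repeats a component by design (single-problem summit)
set_option linter.dupNamespace false

namespace Summit.ValiantsHypothesis.ValiantsHypothesis.Theorems.BorderApolarityToricWitnessObstructionQP

noncomputable section

namespace TLFChart

open Literature.Computability.AlgebraicComplexity
open Border33 (det_eq_linSubst_detPoly mem_orbitClosure_of_tendsto_of_mem linSubst_diagonal_pow_eq_sum)

/-- **Top torus-weight components of (scaled) linear determinants are border determinantal
expressions.**  For an `m × m` matrix `M` of linear forms in the `m²` variables, `c : ℂ`, a weight
`w` and `e` with all `w`-weights of `c · det M` at most `e`, the component of weight `e` lies in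
`Δ[det_m]`. [cite: LandsbergManivelRessayre2013, §2 (toric degenerations of determinants)] -/
theorem top_component_mem_orbitClosure_det {m : ℕ} [NeZero m]
    (M : Matrix (Fin m) (Fin m) (MvPolynomial (Fin m × Fin m) ℂ))
    (hM : ∀ i j, (M i j).IsHomogeneous 1) (c : ℂ) (w : Fin m × Fin m → ℕ) (e : ℕ)
    (hwe : ∀ d ∈ (C c * M.det).support, Finsupp.weight w d ≤ e) :
    weightedHomogeneousComponent w e (C c * M.det) ∈ orbitClosure (detPoly (Fin m) ℂ) := by
  classical
  set Q : MvPolynomial (Fin m × Fin m) ℂ := C c * M.det with hQdef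
  -- `Q = det M'` with `M'` = `M` with row `0` scaled by `c`
  set M' : Matrix (Fin m) (Fin m) (MvPolynomial (Fin m × Fin m) ℂ) :=
    M.updateRow 0 ((C c : MvPolynomial (Fin m × Fin m) ℂ) • M 0) with hM'
  have hM'h : ∀ i j, (M' i j).IsHomogeneous 1 := by
    intro i j
    rw [hM']
    by_cases hi : i = 0
    · subst hi
      rw [Matrix.updateRow_self, Pi.smul_apply, smul_eq_mul]
      exact (hM 0 j).C_mul c
    · rw [Matrix.updateRow_ne hi]
      exact hM i j
  have hQdet : Q = M'.det := by
    rw [hM', Matrix.det_updateRow_smul, Matrix.updateRow_eq_self]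
  -- the rescaled determinants along the torus
  let D : ℂ → Matrix (Fin m × Fin m) (Fin m × Fin m) ℂ := fun s => Matrix.diagonal fun a => s ^ w a
  let Ms : ℂ → Matrix (Fin m) (Fin m) (MvPolynomial (Fin m × Fin m) ℂ) := fun s =>
    (M'.map (linSubst _ ℂ (D s))).updateRow 0
      ((C ((s ^ e)⁻¹) : MvPolynomial (Fin m × Fin m) ℂ) • (M'.map (linSubst _ ℂ (D s))) 0)
  have hMsh : ∀ s i j, (Ms s i j).IsHomogeneous 1 := by
    intro s i j
    simp only [Ms]
    by_cases hi : i = 0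
    · subst hi
      rw [Matrix.updateRow_self, Pi.smul_apply, smul_eq_mul, Matrix.map_apply]
      exact (linSubst_isHomogeneous _ (hM'h 0 j)).C_mul _
    · rw [Matrix.updateRow_ne hi, Matrix.map_apply]
      exact linSubst_isHomogeneous _ (hM'h i j)
  have hdetMs : ∀ s, (Ms s).det =
      ∑ j ∈ Finset.range (e + 1), C ((s ^ e)⁻¹ * s ^ j) * weightedHomogeneousComponent w j Q := by
    intro s
    simp only [Ms]
    rw [Matrix.det_updateRow_smul, Matrix.updateRow_eq_self]
    have hmap : (M'.map (linSubst _ ℂ (D s))).det = linSubst _ ℂ (D s) M'.det := by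
      rw [show M'.map ⇑(linSubst (Fin m × Fin m) ℂ (D s)) =
        (linSubst (Fin m × Fin m) ℂ (D s) : MvPolynomial _ ℂ →+* _).mapMatrix M' from rfl,
        ← RingHom.map_det]
      rfl
    rw [hmap, ← hQdet, linSubst_diagonal_pow_eq_sum w s Q e hwe, Finset.mul_sum]
    refine Finset.sum_congr rfl fun j _ => ?_
    rw [← mul_assoc, ← map_mul]
  -- each rescaled determinant lies in the orbit closure of `det_m`
  have hmem : ∀ s, (Ms s).det ∈ orbitClosure (detPoly (Fin m) ℂ) := by
    intro s
    refine endOrbit_subset_orbitClosure_holds _ ?_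
    exact ⟨_, (det_eq_linSubst_detPoly (Ms s) (hMsh s)).symm⟩
  -- along `s = t + 1 → ∞` they converge coefficientwise to `Q_e`
  have hlim : Tendsto (fun t : ℕ => coeffVec ((Ms ((t : ℂ) + 1)).det)) atTop
      (𝓝 (coeffVec (weightedHomogeneousComponent w e Q))) := by
    rw [tendsto_pi_nhds]
    intro d
    simp only [coeffVec_apply]
    have hrw : ∀ t : ℕ, coeff d ((Ms ((t : ℂ) + 1)).det) =
        ∑ j ∈ Finset.range (e + 1), (((t : ℂ) + 1) ^ e)⁻¹ * ((t : ℂ) + 1) ^ j *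
          coeff d (weightedHomogeneousComponent w j Q) := by
      intro t
      rw [hdetMs, coeff_sum]
      refine Finset.sum_congr rfl fun j _ => ?_
      rw [coeff_C_mul]
    simp_rw [hrw]
    have htarget : coeff d (weightedHomogeneousComponent w e Q) =
        ∑ j ∈ Finset.range (e + 1), (if j = e then 1 else 0) *
          coeff d (weightedHomogeneousComponent w j Q) := by
      simp only [ite_mul, one_mul, zero_mul]
      rw [Finset.sum_ite_eq', if_pos (Finset.mem_range.2 (Nat.lt_succ_self e))]
    rw [htarget]
    refine tendsto_finsetSum _ fun j hj => ?_
    refine Tendsto.mul_const _ ?_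
    have hje : j ≤ e := Nat.lt_succ_iff.1 (Finset.mem_range.1 hj)
    by_cases hj' : j = e
    · subst hj'
      simp only [if_true]
      refine tendsto_const_nhds.congr' ?_
      filter_upwards [Filter.eventually_ge_atTop 0] with t _
      have hne : ((t : ℂ) + 1) ^ j ≠ 0 := pow_ne_zero _ (by
        rw [← Nat.cast_succ]; exact Nat.cast_ne_zero.2 (Nat.succ_ne_zero t))
      rw [inv_mul_cancel₀ hne]
    · rw [if_neg hj']
      have hk : 0 < e - j := by omega
      have h1 : Tendsto (fun t : ℕ => (1 / ((t : ℝ) + 1))) atTop (𝓝 0) :=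
        tendsto_one_div_add_atTop_nhds_zero_nat
      have h2 : Tendsto (fun t : ℕ => ((1 / ((t : ℝ) + 1)) ^ (e - j) : ℝ)) atTop (𝓝 0) := by
        have := h1.pow (e - j)
        rwa [zero_pow hk.ne'] at this
      have h3 : Tendsto (fun t : ℕ => (((1 / ((t : ℝ) + 1)) ^ (e - j) : ℝ) : ℂ)) atTop (𝓝 0) := by
        have := (Complex.continuous_ofReal.tendsto 0).comp h2
        rwa [Complex.ofReal_zero] at this
      refine h3.congr fun t => ?_
      have hne : ((t : ℂ) + 1) ≠ 0 := by
        rw [← Nat.cast_succ]; exact Nat.cast_ne_zero.2 (Nat.succ_ne_zero t)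
      obtain ⟨k, hk⟩ : ∃ k, e = j + k := ⟨e - j, by omega⟩
      have hne' : (1 + (t : ℂ)) ≠ 0 := by rwa [add_comm]
      rw [hk, Nat.add_sub_cancel_left]
      push_cast
      field_simp
      rw [pow_add, mul_left_comm, ← mul_pow, one_div, inv_mul_cancel₀ hne, one_pow, mul_one]
  exact mem_orbitClosure_of_tendsto_of_mem (fun t : ℕ => (Ms ((t : ℂ) + 1)).det) (fun t => hmem _) hlim

/-- `weight` is compatible with renaming of variables. [folklore] -/
theorem weight_mapDomain {σ τ : Type*} (f : σ → τ) (w : τ → ℕ) (d : σ →₀ ℕ) :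
    Finsupp.weight w (d.mapDomain f) = Finsupp.weight (w ∘ f) d := by
  classical
  rw [Finsupp.weight_apply, Finsupp.weight_apply,
    Finsupp.sum_mapDomain_index (h := fun i c => c • w i) (fun _ => zero_smul _ _)
      (fun _ _ _ => add_smul _ _ _)]
  rfl

/-- Weighted components commute with an injective renaming compatible with the weights.
[folklore] -/
theorem weightedHomogeneousComponent_rename {σ τ : Type*} {f : σ → τ} (hf : Function.Injective f)
    (w : τ → ℕ) (j : ℕ) (F : MvPolynomial σ ℂ) :
    weightedHomogeneousComponent w j (rename f F) =
      rename f (weightedHomogeneousComponent (w ∘ f) j F) := by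
  classical
  ext d
  rw [coeff_weightedHomogeneousComponent]
  by_cases hd : ∃ u : σ →₀ ℕ, u.mapDomain f = d
  · obtain ⟨u, rfl⟩ := hd
    rw [coeff_rename_mapDomain f hf, coeff_rename_mapDomain f hf,
      coeff_weightedHomogeneousComponent, weight_mapDomain]
  · simp only [not_exists] at hd
    rw [coeff_rename_eq_zero f _ _ (fun u hu => absurd hu (hd u)),
      coeff_rename_eq_zero f _ _ (fun u hu => absurd hu (hd u))]
    split_ifs <;> rfl

/-- **Torus leading forms are border determinantal expressions.**  A TLF datum
`(e', a₀, γ, G₀, G)` of size `m` for `per_n` with `n < m` (`deg_s det(pencil) ≤ e'`,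
`[s^{e'}] det(pencil) = per_n`) gives `X₀₀^{m-n} · per_n ∈ Δ[det_m]`. [folklore] -/
theorem paddedPerPoly_mem_orbitClosure_of_tlf {n m : ℕ} [NeZero m] (hnm : n < m) (e' a₀ : ℕ)
    (γ : Fin n → Fin n → ℕ) (G₀ : Matrix (Fin m) (Fin m) ℂ) (G : Fin n → Fin n → Matrix (Fin m) (Fin m) ℂ)
    (hdeg : (Matrix.of fun a b : Fin m => Polynomial.monomial a₀ (C (G₀ a b)) +
        ∑ i : Fin n, ∑ j : Fin n, Polynomial.monomial (γ i j) (C (G i j a b) * X (i, j)) :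
          Matrix (Fin m) (Fin m) (Polynomial (MvPolynomial (Fin n × Fin n) ℂ))).det.natDegree ≤ e')
    (hcoeff : (Matrix.of fun a b : Fin m => Polynomial.monomial a₀ (C (G₀ a b)) +
        ∑ i : Fin n, ∑ j : Fin n, Polynomial.monomial (γ i j) (C (G i j a b) * X (i, j)) :
          Matrix (Fin m) (Fin m) (Polynomial (MvPolynomial (Fin n × Fin n) ℂ))).det.coeff e' =
        perPoly (Fin n) ℂ) :
    paddedPerPoly ℂ n m ∈ orbitClosure (detPoly (Fin m) ℂ) := by
  classical
  -- the chart determinant and the chart lemma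
  set Mh : Matrix (Fin m) (Fin m) (MvPolynomial (Option (Fin n × Fin n)) ℂ) :=
    Matrix.of fun a b : Fin m => G₀ a b • X none +
      ∑ i : Fin n, ∑ j : Fin n, G i j a b • X (some (i, j)) with hMh
  set F : MvPolynomial (Option (Fin n × Fin n)) ℂ := Mh.det with hF
  set ŵ : Option (Fin n × Fin n) → ℕ := fun v => v.elim a₀ fun p => γ p.1 p.2 with hŵ
  obtain ⟨-, hwt, htop⟩ := chart hnm.le e' a₀ γ G₀ G hdeg hcoeff F (by rw [hF, hMh]) ŵ hŵ
  -- the renaming into the `m²` variables: `none ↦ (0,0)`, the `y`-variables onto the block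
  set ε : Fin n ≃ BlockIdx n m := (Fintype.equivFinOfCardEq (card_blockIdx hnm.le)).symm with hε
  set ι : Option (Fin n × Fin n) → Fin m × Fin m :=
    fun v => v.elim ((0 : Fin m), (0 : Fin m)) fun p => ((ε p.1 : Fin m), (ε p.2 : Fin m)) with hι
  have hblock0 : ∀ i : Fin n, ((ε i : Fin m) : ℕ) ≠ 0 := by
    intro i
    have := (ε i).2
    omega
  have hιinj : Function.Injective ι := by
    intro u v huv
    cases u with
    | none =>
      cases v with
      | none => rfl
      | some q =>
        exfalso
        simp only [hι, Option.elim_none, Option.elim_some, Prod.mk.injEq] at huv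
        exact hblock0 q.1 (by rw [← huv.1]; rfl)
    | some p =>
      cases v with
      | none =>
        exfalso
        simp only [hι, Option.elim_none, Option.elim_some, Prod.mk.injEq] at huv
        exact hblock0 p.1 (by rw [huv.1]; rfl)
      | some q =>
        simp only [hι, Option.elim_some, Prod.mk.injEq] at huv
        obtain ⟨h1, h2⟩ := huv
        have h1' : p.1 = q.1 := ε.injective (Subtype.ext h1)
        have h2' : p.2 = q.2 := ε.injective (Subtype.ext h2)
        rw [Option.some.injEq]
        exact Prod.ext h1' h2'
  -- weights on the `m²` variables restricting to `ŵ` along `ι`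
  set w' : Fin m × Fin m → ℕ := fun v => if v = ((0 : Fin m), (0 : Fin m)) then a₀ else
    if h : m - n ≤ (v.1 : ℕ) ∧ m - n ≤ (v.2 : ℕ) then γ (ε.symm ⟨v.1, h.1⟩) (ε.symm ⟨v.2, h.2⟩)
    else 0 with hw'
  have hw'ι : w' ∘ ι = ŵ := by
    funext v
    cases v with
    | none => simp [hw', hι, hŵ]
    | some p =>
      simp only [Function.comp_apply, hι, hŵ, Option.elim_some, hw']
      have hne : (((ε p.1 : Fin m), (ε p.2 : Fin m)) : Fin m × Fin m) ≠ ((0 : Fin m), (0 : Fin m)) := by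
        intro h
        rw [Prod.mk.injEq] at h
        exact hblock0 p.1 (by rw [h.1]; rfl)
      rw [if_neg hne, dif_pos ⟨(ε p.1).2, (ε p.2).2⟩]
      simp only [Subtype.coe_eta, Equiv.symm_apply_apply]
  -- the renamed chart determinant is a linear determinant in the `m²` variables
  set M' : Matrix (Fin m) (Fin m) (MvPolynomial (Fin m × Fin m) ℂ) := Mh.map (rename ι) with hM'
  have hM'h : ∀ i j, (M' i j).IsHomogeneous 1 := by
    intro i j
    rw [hM', Matrix.map_apply, hMh, Matrix.of_apply]
    refine IsHomogeneous.rename_isHomogeneous ?_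
    refine IsHomogeneous.add (isHomogeneous_smul (isHomogeneous_X ℂ _) _) ?_
    refine IsHomogeneous.sum _ _ _ fun i' _ => IsHomogeneous.sum _ _ _ fun j' _ => ?_
    exact isHomogeneous_smul (isHomogeneous_X ℂ _) _
  have hM'det : M'.det = rename ι F := by
    rw [hF, hM', AlgHom.map_det, AlgHom.mapMatrix_apply]
  -- weights of the renamed determinant and its top component
  have hwe' : ∀ d ∈ (C (1 : ℂ) * M'.det).support, Finsupp.weight w' d ≤ e' := by
    intro d hd
    rw [C_1, one_mul, hM'det] at hd
    obtain ⟨u, hu, rfl⟩ := Finset.mem_image.mp (support_rename_of_injective hιinj (p := F) ▸ hd)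
    rw [weight_mapDomain, hw'ι]
    exact hwt u hu
  have htop' : weightedHomogeneousComponent w' e' (C (1 : ℂ) * M'.det) = paddedPerPoly ℂ n m := by
    rw [C_1, one_mul, hM'det, weightedHomogeneousComponent_rename hιinj, hw'ι, htop, map_mul,
      map_pow, rename_X, rename_rename]
    have hι0 : ι none = ((0 : Fin m), (0 : Fin m)) := rfl
    have hper : perPoly (BlockIdx n m) ℂ = rename (Prod.map ε ε) (perPoly (Fin n) ℂ) :=
      (rename_perPoly_equiv ε).symm
    rw [hι0, paddedPerPoly, hper, rename_rename]
    rfl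
  have h := top_component_mem_orbitClosure_det M' hM'h 1 w' e' hwe'
  rwa [htop'] at h

end TLFChart

/-- **Torus leading forms are border determinantal expressions** (registered helper form of
`TLFChart.paddedPerPoly_mem_orbitClosure_of_tlf`; the disprover's §5(c) made a theorem): a TLF
datum of size `m > n` for `per_n` gives `X₀₀^{m-n} per_n ∈ Δ[det_m]`, i.e. `bdc(per_n) ≤ m`.
[folklore] -/
theorem tlf_paddedPerPoly_mem_orbitClosure : ∀ {n m : ℕ} [NeZero m], n < m → ∀ (e' a₀ : ℕ) (γ : Fin n → Fin n → ℕ) (G₀ : Matrix (Fin m) (Fin m) ℂ) (G : Fin n → Fin n → Matrix (Fin m) (Fin m) ℂ), (Matrix.of fun a b : Fin m => Polynomial.monomial a₀ (MvPolynomial.C (G₀ a b)) + ∑ i : Fin n, ∑ j : Fin n, Polynomial.monomial (γ i j) (MvPolynomial.C (G i j a b) * MvPolynomial.X (i, j)) : Matrix (Fin m) (Fin m) (Polynomial (MvPolynomial (Fin n × Fin n) ℂ))).det.natDegree ≤ e' → (Matrix.of fun a b : Fin m => Polynomial.monomial a₀ (MvPolynomial.C (G₀ a b)) + ∑ i : Fin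 n, ∑ j : Fin n, Polynomial.monomial (γ i j) (MvPolynomial.C (G i j a b) * MvPolynomial.X (i, j)) : Matrix (Fin m) (Fin m) (Polynomial (MvPolynomial (Fin n × Fin n) ℂ))).det.coeff e' = Literature.Computability.AlgebraicComplexity.perPoly (Fin n) ℂ → Literature.Computability.AlgebraicComplexity.paddedPerPoly ℂ n m ∈ Literature.Computability.AlgebraicComplexity.orbitClosure (Literature.Computability.AlgebraicComplexity.detPoly (Fin m) ℂ) :=
  fun hnm e' a₀ γ G₀ G hdeg hcoeff =>
    TLFChart.paddedPerPoly_mem_orbitClosure_of_tlf hnm e' a₀ γ G₀ G hdeg hcoeff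

/-- **LMR bound for torus leading forms** (registered helper): a TLF datum of size `m > n` for
`per_n` forces `n² ≤ 2m` (Landsberg–Manivel–Ressayre 2013, Thm 1.1.1, in tree); e.g. there is no
TLF(3,4) and no TLF(4,7). [cite: LandsbergManivelRessayre2013, Theorem 1.1.1] -/
theorem tlf_sq_le_two_mul : ∀ {n m : ℕ} [NeZero m], n < m → ∀ (e' a₀ : ℕ) (γ : Fin n → Fin n → ℕ) (G₀ : Matrix (Fin m) (Fin m) ℂ) (G : Fin n → Fin n → Matrix (Fin m) (Fin m) ℂ), (Matrix.of fun a b : Fin m => Polynomial.monomial a₀ (MvPolynomial.C (G₀ a b)) + ∑ i : Fin n, ∑ j : Fin n, Polynomial.monomial (γ i j) (MvPolynomial.C (G i j a b) * MvPolynomial.X (i, j)) : Matrix (Fin m) (Fin m) (Polynomial (MvPolynomial (Fin n × Fin n) ℂ))).det.natDegree ≤ e' → (Matrix.of fun a b : Fin m => Polynomial.monomial a₀ (MvPolynomial.C (G₀ a b)) + ∑ i : Fin n, ∑ j : Fin n, Polynomial.monomial (γ i j) (MvPolynomial.C (G i j a b) * MvPolynomial.X (i, j)) : Matrix (Fin m)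 (Fin m) (Polynomial (MvPolynomial (Fin n × Fin n) ℂ))).det.coeff e' = Literature.Computability.AlgebraicComplexity.perPoly (Fin n) ℂ → n ^ 2 ≤ 2 * m :=
  fun hnm e' a₀ γ G₀ G hdeg hcoeff =>
    Literature.Computability.AlgebraicComplexity.LMR2013_thm_1_1_1_holds _ _ hnm.le
      (TLFChart.paddedPerPoly_mem_orbitClosure_of_tlf hnm e' a₀ γ G₀ G hdeg hcoeff)

end

end Summit.ValiantsHypothesis.ValiantsHypothesis.Theorems.BorderApolarityToricWitnessObstructionQP
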